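import Summits.QuantumAdvantage.QuantumAdvantage.Theorems.CubicForrelationNearExactIsExactIsolationSmallN
import Literature.Computability.QuantumComplexity.ForrelationSignTransport
import HarnessLib

/-!
# Type-O cubics on 12 bits: the 2-adic digits of `W_g/16` (NearExactIsExact, disprover's structure file, part 1)

Negative-side STRUCTURE for the crux `CubicForrelation.NearExactIsExact` (item `near_exact_is_exact`) at `n = 12`,
from the B2b disprover seat. HONEST FRAMING: theorems about the finite slice `n = 12` (where the window `(57/64, 1)`
for cubic pairs is searched), NOT summit progress. Part 2 (`TypeOTwelve`) assembles them into the type-O capacity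
bound `Σ|W_g| ≤ 2^{18}·1963/2048` and the isolation constant `1963/2048` at `n = 12`.

For cubic `g : 𝔽₂¹² → 𝔽₂`, `W_g = 16·u` with `u ∈ ℤ` (`tw_base`). Contents:
* `cube_sum_dvd`: `2^r ∣ Σ_{x ∈ E_I} u(x)` whenever `r + 4 ≤ |I| + ⌈(12 − |I|)/3⌉` (Poisson over the coordinate cube
  `E_I` + Ax's theorem on `E_{Iᶜ}` — the pattern of `stub_walshTower`, kept with the exponent explicit);
* DIGITS: if every `u(x)` is odd ("type O"), `u = 2u₁ + 1`, `u₁ = 2u₂ + (u₁ mod 2)`, then `[u₁ odd]` is AFFINE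
  (`digit_two`, cubes with `|I| ≥ 2`) and `[u₂ odd]` is CUBIC (`digit_three`, cubes with `|I| ≥ 4`, using that an affine
  function has weight `≡ 0 (mod 4)` on every cube of dimension `≥ 3` — Ax with `d = 1`);
* `typeO_of_exists_odd`: one odd `u(x)` forces all odd (degree-`0` parity + the Reed–Muller weight bound);
* `sum_signOf_affine_mul_W_le`: an AFFINE sign pattern sees at most one Walsh value of any `g`:
  `Σ_x (−1)^{τ(x)} W_g(x) ≤ 2^{12}` (kernel symmetry, `W_τ ∈ 2^{12}ℤ` by Ax with `d = 1`, Parseval `Σ z_y² = 1`);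
* Parseval at level 4 (`sum_u_sq`: `Σ u² = 2^{16}`) and three pointwise integer inequalities (`pt_odd`, `pt_pm_one`,
  `pt_five`) with their equality cases in the docstrings.

Sources: J. Ax (1964) / R. McEliece (1972) (Carlet 2021 §4.1); MacWilliams–Sloane Ch. 13–14 (Reed–Muller weights,
Poisson summation); R. O'Donnell, Analysis of Boolean Functions (2014) §1.4 (Parseval). Axioms: the standard three.
-/

set_option linter.dupNamespace false -- D-0017: single-problem summit ⇒ `QuantumAdvantage.QuantumAdvantage` by design

noncomputable section

namespace Summit.QuantumAdvantage.QuantumAdvantage.Theorems.NearExactIsExact.Negative.TypeOTwelve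

open Finset
open Literature.Computability.QuantumComplexity
open Literature.Computability.QuantumComplexity.DerivativeWalsh (W fsum fsum_eq_sum_mul_W fsum_eq_sum_mul_W' sum_W_sq)
open Summit.QuantumAdvantage.QuantumAdvantage.Theorems.CubicForrelation.NearExactIsExact
open Summit.QuantumAdvantage.QuantumAdvantage.Theorems.SignedCubicForrelationNotPrBPP (knf_isDegLeFun_ip)
open Summit.QuantumAdvantage.QuantumAdvantage.Theorems.SignedCubicForrelationNotPrBPP.Negative.HalfQuad (forrelation_comm)

/-! ### Cube sums of the level-4 quotient `u = W_g / 16` -/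

section Digits

variable (g : (Fin (6 + 6) → Bool) → Bool) (u : (Fin (6 + 6) → Bool) → ℤ)

/-- The coordinate cube `E_I` has `2^{|I|}` points (cast to `ℤ`). -/
theorem card_cube_int (I : Finset (Fin (6 + 6))) :
    (#({x : Fin (6 + 6) → Bool | ∀ i, x i = true → i ∈ I} : Finset _) : ℤ) = 2 ^ #I := by
  rw [bb_card_cube I]; push_cast; rfl

/-- **Level-4 cube sums.** For cubic `g` on `12` bits with `W_g = 16·u`: `2^r ∣ Σ_{x ∈ E_I} u(x)` whenever
`r + 4 ≤ |I| + ⌈(12 − |I|)/3⌉` (Poisson summation over `E_I` + Ax's theorem on `E_{Iᶜ}`, as in `stub_walshTower`). -/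
theorem cube_sum_dvd (hg : IsDegLeFun 3 g) (hu : ∀ x, W (fun y => signOf (g y)) x = (2 : ℝ) ^ 4 * (u x : ℝ))
    (I : Finset (Fin (6 + 6))) (r : ℕ) (hr : r + 4 ≤ #I + (6 + 6 - #I + 2) / 3) :
    (2 : ℤ) ^ r ∣ ∑ x ∈ {x : Fin (6 + 6) → Bool | ∀ i, x i = true → i ∈ I}, u x := by
  have hP := bb_poisson (fun y => signOf (g y)) I
  obtain ⟨z, hz⟩ := stub_axParity (6 + 6) 3 g Iᶜ (by norm_num) hg
  generalize hc : (Iᶜ.card + 3 - 1) / 3 = c at hz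
  rw [sum_congr rfl fun x _ => hu x, ← mul_sum, hz] at hP
  have hk : #I ≤ 6 + 6 := (card_le_univ I).trans_eq (Fintype.card_fin _)
  have hj : #Iᶜ = 6 + 6 - #I := by rw [card_compl, Fintype.card_fin]
  have hrc : r + 4 ≤ #I + c := by omega
  have hZ : (2 : ℤ) ^ 4 * ∑ x ∈ {x : Fin (6 + 6) → Bool | ∀ i, x i = true → i ∈ I}, u x =
      2 ^ #I * (2 ^ c * z) := by
    exact_mod_cast hP
  obtain ⟨e, he⟩ : ∃ e, #I + c = 4 + r + e := ⟨#I + c - 4 - r, by omega⟩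
  refine ⟨2 ^ e * z, ?_⟩
  have h0 : (2 : ℤ) ^ 4 ≠ 0 := by positivity
  apply mul_left_cancel₀ h0
  rw [hZ, show (2 : ℤ) ^ #I * (2 ^ c * z) = 2 ^ (#I + c) * z by ring, he]
  ring

/-- **The second 2-adic digit is affine.** If moreover every `u(x)` is odd, `u = 2u₁ + 1`, then `x ↦ [u₁(x) odd]`
has algebraic degree `≤ 1`: for `|I| ≥ 2`, `4 ∣ Σ_{E_I} u = 2 Σ_{E_I} u₁ + 2^{|I|}`, so `Σ_{E_I} u₁` is even. -/
theorem digit_two (hg : IsDegLeFun 3 g) (hu : ∀ x, W (fun y => signOf (g y)) x = (2 : ℝ) ^ 4 * (u x : ℝ))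
    (u₁ : (Fin (6 + 6) → Bool) → ℤ) (h1 : ∀ x, u x = 2 * u₁ x + 1) :
    IsDegLeFun 1 (fun x => decide (Odd (u₁ x))) := by
  refine bb_moebius_isDegLeFun 1 _ fun I hI => ?_
  have hk : #I ≤ 6 + 6 := (card_le_univ I).trans_eq (Fintype.card_fin _)
  obtain ⟨k, hk4⟩ := cube_sum_dvd g u hg hu I 2 (by omega)
  have hsum : ∑ x ∈ {x : Fin (6 + 6) → Bool | ∀ i, x i = true → i ∈ I}, u x =
      2 * ∑ x ∈ {x : Fin (6 + 6) → Bool | ∀ i, x i = true → i ∈ I}, u₁ x + 2 ^ #I := by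
    rw [sum_congr rfl fun x _ => h1 x, sum_add_distrib, mul_sum, sum_const, nsmul_eq_mul, mul_one, card_cube_int]
  obtain ⟨a, ha⟩ : ∃ a, #I = a + 2 := ⟨#I - 2, by omega⟩
  rw [ha, pow_add, hk4] at hsum
  have hE : Even (∑ x ∈ {x : Fin (6 + 6) → Bool | ∀ i, x i = true → i ∈ I}, u₁ x) :=
    ⟨k - 2 ^ a, by linarith⟩
  have h := (tw_even_sum_iff _ u₁).1 hE
  rw [filter_filter] at h
  simpa only [decide_eq_true_eq] using h

/-- **The third 2-adic digit is cubic.** With `u = 2u₁ + 1`, `u₁ = 2u₂ + t`, `t = [u₁ odd] ∈ {0,1}`: `x ↦ [u₂(x) odd]`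
has algebraic degree `≤ 3`: for `|I| ≥ 4`, `8 ∣ Σ_{E_I} u = 4 Σ u₂ + 2 Σ t + 2^{|I|}` and `4 ∣ Σ_{E_I} t` because
`t` is (the indicator of) an affine function restricted to a cube of dimension `≥ 3` (Ax's theorem with `d = 1`). -/
theorem digit_three (hg : IsDegLeFun 3 g) (hu : ∀ x, W (fun y => signOf (g y)) x = (2 : ℝ) ^ 4 * (u x : ℝ))
    (u₁ u₂ t : (Fin (6 + 6) → Bool) → ℤ) (h1 : ∀ x, u x = 2 * u₁ x + 1) (h2 : ∀ x, u₁ x = 2 * u₂ x + t x)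
    (ht : ∀ x, t x = if Odd (u₁ x) then 1 else 0) :
    IsDegLeFun 3 (fun x => decide (Odd (u₂ x))) := by
  have hτ : IsDegLeFun 1 (fun x => decide (Odd (u₁ x))) := digit_two g u hg hu u₁ h1
  refine bb_moebius_isDegLeFun 3 _ fun I hI => ?_
  have hk : #I ≤ 6 + 6 := (card_le_univ I).trans_eq (Fintype.card_fin _)
  obtain ⟨k, hk8⟩ := cube_sum_dvd g u hg hu I 3 (by omega)
  obtain ⟨z, hz⟩ := stub_axParity (6 + 6) 1 (fun x => decide (Odd (u₁ x))) I le_rfl hτ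
  have hexp : (#I + 1 - 1) / 1 = #I := by simp
  have hsign : ∀ x, signOf (decide (Odd (u₁ x))) = 1 - 2 * (t x : ℝ) := fun x => by
    rw [ht x]
    by_cases h : Odd (u₁ x)
    · simp [h, signOf]; norm_num
    · simp [h, signOf]
  rw [hexp, sum_congr rfl fun x _ => hsign x, sum_sub_distrib, sum_const, nsmul_eq_mul, mul_one, ← mul_sum] at hz
  have hcardR : ((#({x : Fin (6 + 6) → Bool | ∀ i, x i = true → i ∈ I} : Finset _) : ℕ) : ℝ) = (2 : ℝ) ^ #I := by
    rw [bb_card_cube I]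
    push_cast
    rfl
  rw [hcardR] at hz
  have hT : (2 : ℤ) ^ #I - 2 * ∑ x ∈ {x : Fin (6 + 6) → Bool | ∀ i, x i = true → i ∈ I}, t x = 2 ^ #I * z := by
    exact_mod_cast hz
  have hsum : ∑ x ∈ {x : Fin (6 + 6) → Bool | ∀ i, x i = true → i ∈ I}, u x =
      4 * ∑ x ∈ {x : Fin (6 + 6) → Bool | ∀ i, x i = true → i ∈ I}, u₂ x +
        2 * ∑ x ∈ {x : Fin (6 + 6) → Bool | ∀ i, x i = true → i ∈ I}, t x + 2 ^ #I := by
    rw [sum_congr rfl fun x _ => by rw [h1 x, h2 x], sum_add_distrib, sum_const, nsmul_eq_mul, mul_one,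
      card_cube_int, mul_sum, mul_sum, ← sum_add_distrib]
    exact congrArg (· + _) (sum_congr rfl fun x _ => by ring)
  obtain ⟨a, ha⟩ : ∃ a, #I = a + 4 := ⟨#I - 4, by omega⟩
  rw [ha, pow_add] at hsum hT
  rw [hk8] at hsum
  have hE : Even (∑ x ∈ {x : Fin (6 + 6) → Bool | ∀ i, x i = true → i ∈ I}, u₂ x) :=
    ⟨k - 2 ^ a * (4 - 2 * z), by linarith⟩
  have h := (tw_even_sum_iff _ u₂).1 hE
  rw [filter_filter] at h
  simpa only [decide_eq_true_eq] using h

end Digits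

/-! ### Elementary pointwise inequalities -/

/-- `|z| = z ∨ |z| = -z`-style case analysis: for odd `v`, `8|v| ≤ v² + 15` (equality iff `|v| ∈ {3,5}`). -/
theorem pt_odd (v : ℤ) (hodd : v % 2 = 1) : 8 * |v| ≤ v ^ 2 + 15 := by
  rcases abs_choice v with h | h <;> rw [h]
  · rcases le_or_gt v 3 with h3 | h3
    · nlinarith [mul_nonneg (show (0 : ℤ) ≤ 3 - v by omega) (show (0 : ℤ) ≤ 5 - v by omega)]
    · nlinarith [mul_nonneg (show (0 : ℤ) ≤ v - 3 by omega) (show (0 : ℤ) ≤ v - 5 by omega)]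
  · rcases le_or_gt (-3) v with h3 | h3
    · nlinarith [mul_nonneg (show (0 : ℤ) ≤ v + 3 by omega) (show (0 : ℤ) ≤ v + 5 by omega)]
    · nlinarith [mul_nonneg (show (0 : ℤ) ≤ -3 - v by omega) (show (0 : ℤ) ≤ -5 - v by omega)]

/-- For `v ≡ ±1 (mod 8)`: `8|v| + 8 ≤ v² + 15` (equality iff `|v| ∈ {1,7}`). -/
theorem pt_pm_one (v : ℤ) (h8 : v % 8 = 1 ∨ v % 8 = 7) : 8 * |v| + 8 ≤ v ^ 2 + 15 := by
  rcases abs_choice v with h | h <;> rw [h]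
  · rcases le_or_gt v 1 with h1 | h1
    · nlinarith [mul_nonneg (show (0 : ℤ) ≤ 1 - v by omega) (show (0 : ℤ) ≤ 7 - v by omega)]
    · nlinarith [mul_nonneg (show (0 : ℤ) ≤ v - 1 by omega) (show (0 : ℤ) ≤ v - 7 by omega)]
  · rcases le_or_gt (-1) v with h1 | h1
    · nlinarith [mul_nonneg (show (0 : ℤ) ≤ v + 1 by omega) (show (0 : ℤ) ≤ v + 7 by omega)]
    · nlinarith [mul_nonneg (show (0 : ℤ) ≤ -1 - v by omega) (show (0 : ℤ) ≤ -7 - v by omega)]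

/-- For `s ≡ 5 (mod 8)`: `64|s| ≤ 5s² + 6s + 165` (equality iff `s ∈ {5, −3, −11}`). -/
theorem pt_five (s : ℤ) (h8 : s % 8 = 5) : 64 * |s| ≤ 5 * s ^ 2 + 6 * s + 165 := by
  rcases abs_choice s with h | h <;> rw [h]
  · rcases le_or_gt s 5 with h5 | h5
    · rcases lt_or_ge s 0 with h0 | h0
      · rcases le_or_gt (-3) s with h3 | h3
        · nlinarith [mul_nonneg (show (0 : ℤ) ≤ s + 3 by omega) (show (0 : ℤ) ≤ s + 11 by omega)]
        · nlinarith [mul_nonneg (show (0 : ℤ) ≤ -3 - s by omega) (show (0 : ℤ) ≤ -11 - s by omega)]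
      · obtain rfl : s = 5 := by omega
        norm_num
    · nlinarith [mul_nonneg (show (0 : ℤ) ≤ 5 * s - 33 by omega) (show (0 : ℤ) ≤ s - 5 by omega)]
  · rcases le_or_gt (-3) s with h3 | h3
    · nlinarith [mul_nonneg (show (0 : ℤ) ≤ s + 3 by omega) (show (0 : ℤ) ≤ s + 11 by omega)]
    · nlinarith [mul_nonneg (show (0 : ℤ) ≤ -3 - s by omega) (show (0 : ℤ) ≤ -11 - s by omega)]

/-! ### Walsh sums against an affine sign pattern -/

section Affine

variable (g : (Fin (6 + 6) → Bool) → Bool) (τ : (Fin (6 + 6) → Bool) → Bool)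

/-- The Walsh values of (the sign function of) an AFFINE Boolean function on `12` bits lie in `2^{12} ℤ`
(Ax's theorem with `d = 1` on the full cube, applied to `τ ⊕ ℓ_y`). -/
theorem W_affine_granular (hτ : IsDegLeFun 1 τ) (y : Fin (6 + 6) → Bool) :
    ∃ z : ℤ, W (fun x => signOf (τ x)) y = (2 : ℝ) ^ 12 * (z : ℝ) := by
  have hdeg : IsDegLeFun 1 (fun x : Fin (6 + 6) → Bool =>
      τ x ^^ decide (Odd (univ.filter fun i => x i && y i).card)) :=
    bb_isDegLeFun_bxor hτ (knf_isDegLeFun_ip y)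
  obtain ⟨z, hz⟩ := stub_axParity (6 + 6) 1 _ univ le_rfl hdeg
  refine ⟨z, ?_⟩
  rw [filter_true_of_mem (fun u _ i _ => mem_univ i), card_univ, Fintype.card_fin] at hz
  rw [vg_W_eq_sum_signOf_bxor, hz]

/-- **An affine sign pattern sees at most one Walsh value.** For affine `τ` and ANY Boolean `g` on `12` bits,
`Σ_x (−1)^{τ(x)} W_g(x) ≤ 2^{12}`: by the symmetry of the Walsh kernel the sum is `Σ_y (−1)^{g(y)} W_τ(y)` with
`W_τ(y) = 2^{12} z_y`, `z_y ∈ ℤ`, and Parseval gives `Σ_y z_y² = 1`. -/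
theorem sum_signOf_affine_mul_W_le (hτ : IsDegLeFun 1 τ) :
    ∑ x, signOf (τ x) * W (fun y => signOf (g y)) x ≤ (2 : ℝ) ^ 12 := by
  rw [← fsum_eq_sum_mul_W, fsum_eq_sum_mul_W']
  choose z hz using W_affine_granular τ hτ
  have h1 : ∀ b : Bool, signOf b ^ 2 = (1 : ℝ) := fun b => by unfold signOf; split_ifs <;> norm_num
  have hPar := sum_W_sq (fun x => signOf (τ x))
  rw [sum_congr rfl fun y _ => by rw [hz y], sum_congr rfl fun y _ => h1 _, sum_const, card_univ,
    Fintype.card_fun, Fintype.card_bool, Fintype.card_fin] at hPar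
  have hz2 : ∑ y, (z y : ℝ) ^ 2 = 1 := by
    have e : ∑ y, ((2 : ℝ) ^ 12 * (z y : ℝ)) ^ 2 = (2 : ℝ) ^ 24 * ∑ y, (z y : ℝ) ^ 2 := by
      rw [mul_sum]
      exact sum_congr rfl fun y _ => by ring
    rw [e] at hPar
    norm_num at hPar
    linarith
  have hzI : ∑ y, z y ^ 2 = 1 := by exact_mod_cast hz2
  have hbound : ∀ y, signOf (g y) * W (fun x => signOf (τ x)) y ≤ (2 : ℝ) ^ 12 * ((z y ^ 2 : ℤ) : ℝ) := by
    intro y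
    rw [hz y]
    have ha : |signOf (g y)| = 1 := abs_signOf _
    have hzi : |z y| ≤ z y ^ 2 := by rw [Int.abs_eq_natAbs]; exact Int.natAbs_le_self_sq (z y)
    have hzz : (|z y| : ℝ) ≤ ((z y ^ 2 : ℤ) : ℝ) := by exact_mod_cast hzi
    calc signOf (g y) * ((2 : ℝ) ^ 12 * (z y : ℝ)) ≤ |signOf (g y) * ((2 : ℝ) ^ 12 * (z y : ℝ))| := le_abs_self _
      _ = (2 : ℝ) ^ 12 * |(z y : ℝ)| := by rw [abs_mul, ha, one_mul, abs_mul, abs_of_pos (by positivity)]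
      _ ≤ (2 : ℝ) ^ 12 * ((z y ^ 2 : ℤ) : ℝ) := mul_le_mul_of_nonneg_left hzz (by positivity)
  calc ∑ y, signOf (g y) * W (fun x => signOf (τ x)) y ≤ ∑ y, (2 : ℝ) ^ 12 * ((z y ^ 2 : ℤ) : ℝ) :=
      sum_le_sum fun y _ => hbound y
    _ = (2 : ℝ) ^ 12 * ((∑ y, z y ^ 2 : ℤ) : ℝ) := by rw [← mul_sum]; push_cast; rfl
    _ = (2 : ℝ) ^ 12 := by rw [hzI]; simp

end Affine

/-! ### Parseval at level 4 and the all-or-nothing parity -/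

section LevelFour

variable (g : (Fin (6 + 6) → Bool) → Bool) (u : (Fin (6 + 6) → Bool) → ℤ)

/-- Parseval at level 4: `W_g = 16u ⇒ Σ_x u(x)² = 2^{16}`. -/
theorem sum_u_sq (hu : ∀ x, W (fun y => signOf (g y)) x = (2 : ℝ) ^ 4 * (u x : ℝ)) :
    ∑ x, u x ^ 2 = 2 ^ 16 := by
  have hP := sum_W_sq (fun y => signOf (g y))
  have h1 : ∀ b : Bool, signOf b ^ 2 = (1 : ℝ) := fun b => by unfold signOf; split_ifs <;> norm_num
  have hL : ∑ x, W (fun y => signOf (g y)) x ^ 2 = (2 : ℝ) ^ 8 * ∑ x, (u x : ℝ) ^ 2 := by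
    rw [mul_sum]
    exact sum_congr rfl fun x _ => by rw [hu x]; ring
  rw [hL, sum_congr rfl fun y _ => h1 _, sum_const, card_univ, Fintype.card_fun, Fintype.card_bool,
    Fintype.card_fin] at hP
  norm_num at hP
  have h2 : ∑ x, (u x : ℝ) ^ 2 = 2 ^ 16 := by linarith
  exact_mod_cast h2

/-- **Type O is all-or-nothing at the Ax level.** For cubic `g` on `12` bits with `W_g = 16u`: one odd `u(x)` forces
all `u(x)` odd (the parity `[u odd]` has degree `≤ 0` by `stub_walshTower`, and a non-zero constant-degree function is
everywhere `1` by the Reed–Muller weight bound with `d = 0`). -/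
theorem typeO_of_exists_odd (hg : IsDegLeFun 3 g)
    (hu : ∀ x, W (fun y => signOf (g y)) x = (2 : ℝ) ^ 4 * (u x : ℝ)) (h : ∃ x, Odd (u x)) :
    ∀ x, Odd (u x) := by
  have hdeg := stub_walshTower stub_axParity (6 + 6) 4 0 g u hg hu (by intro k hk hkn; omega)
  obtain ⟨x₀, hx₀⟩ := h
  have hrm := bb_rmWeight_holds (6 + 6) 0 _ hdeg ⟨x₀, decide_eq_true hx₀⟩
  intro x
  by_contra hx
  have hlt : #(univ.filter fun x => decide (Odd (u x)) = true) < 2 ^ (6 + 6) := by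
    calc #(univ.filter fun x => decide (Odd (u x)) = true) < #(univ : Finset (Fin (6 + 6) → Bool)) := by
          apply card_lt_card
          refine (ssubset_iff_of_subset (filter_subset _ _)).2 ⟨x, mem_univ _, ?_⟩
          simp [hx]
      _ = 2 ^ (6 + 6) := by rw [card_univ, Fintype.card_fun, Fintype.card_bool, Fintype.card_fin]
  omega

end LevelFour

end Summit.QuantumAdvantage.QuantumAdvantage.Theorems.NearExactIsExact.Negative.TypeOTwelve
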